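import Summits.ResolutionOfSingularities.ResolutionOfSingularities.Theorems.PurelyInseparableDim4JointForestDepthTwoKitWaiting
import Summits.ResolutionOfSingularities.ResolutionOfSingularities.Theorems.PurelyInseparableDim4JointTwoChartComputations
import HarnessLib

/-!
# Purely inseparable four-folds: THREE 3-FOLDS `V(z, x₂) ∪ V(z, x₁) ∪ V(z, x₁ − 1)` — a host with TWO WAITING MEMBERS on one chart,
# certified by the v3-lite kit, every `p` (brick S3 (c) «joint point∘coordinate chains», part 43 = instance inst₁₃; cell `res-dim4-pi`)

[OURS · counted 0] (D-0157 DOOR 2; desk WORD #66 (4)(c), #74 (g), #99 (d); frame `PIDim4.TerminationImpliesOrderReduction`, S3 (c)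
v3-lite; host item stmt-ResolutionOfSingularities-16155, helper). Nothing here proves resolution of singularities in dimension ≥ 4 /
characteristic `p` — NOT here, not anywhere in this programme.

`F = (x₁² − x₁)^p x₂^p x₃ = x₁^{2p} x₂^p x₃ − x₁^p x₂^p x₃` over `K = K̄` of characteristic `p` (variables `x₁…x₄` = `X 0…X 3`). Order-`p`
locus: `b₂ = 0 ∨ b₁ = 0 ∨ b₁ = 1` (`roots_twoWaiting`: `∂F/∂x₃ = (x₁² − x₁)^p x₂^p`) — three 3-folds; `V(z, x₂)` MEETS the other two,
which are disjoint from each other. v3-lite: HOST `(0, S₀ = {x₂})`; TWO WAITING ENTRIES `(x₂, 0, {x₁})` and `(x₂, e₁, {x₁})` on the SAME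
chart, separated on `T ∩ T′ = {x₁}` by `c₁ = 0 ≠ 1 = c′₁` (the kit's `hW2`). Host chart `x₂` reads `(x₁^{2p} − x₁^p)·x₃`
(`chartTransform_S_twoWaiting`), whose equimultiple pairs have `b₁ ∈ {0, 1}` (`cases_twoWaiting`) = the two waiting kids; their states
`(x₁^{2p} ∓ x₁^p) x₃` (`step_zero/one_twoWaiting`) read `(x₁^p ∓ 1) x₃` after blowing up `V(z′, x₁)` — a unit times `x₃`, DEAD
(`not_isEquimultiplePoint_T_twoWaiting`).

* §1 computations; §2 **`exists_isMarkedResolution_inst₁₃`** — `(𝔸⁵_K, (z^p + (x₁² − x₁)^p x₂^p x₃)·𝒪, [], p)` admits a marked resolution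
  (BGMW Def. 3.1.3), by part 41's kit with `Pl = L = ∅`, `Wt = {(x₂, 0, {x₁}), (x₂, e₁, {x₁})}`. UNCONDITIONAL, every `p`.

AI-produced formalisation, weaker than expert review. bears_on: LADDER-RESOLUTION:D157-DOOR2 (res-dim4-pi · S3 (c) joint v3-lite · two
waiting members instance).
-/

set_option linter.dupNamespace false -- D-0017: single-problem summit path `Summit.<S>.<S>.…` by design

noncomputable section

open MvPolynomial Finset CategoryTheory AlgebraicGeometry Opposite TopologicalSpace

namespace Summit.ResolutionOfSingularities.ResolutionOfSingularities.Theorems.PIDim4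

open Literature.AlgebraicGeometry.Resolution
open Literature.AlgebraicGeometry.Resolution.Hauser2010
open Literature.AlgebraicGeometry.Resolution.AffinePointBlowup (P A γ coord Wtop ξ)

namespace Equimultiple

section Instance₁₃

variable {K : Type} [Field K] {p : ℕ} [hp : Fact p.Prime] [CharP K p]

/-! ## §1 Computations -/

omit hp [CharP K p] in
/-- `F` as a sum of two monomials. [folklore] -/
theorem twoWaiting_eq_monomial_add :
    (X 0 ^ (2 * p) * X 1 ^ p * X 2 - X 0 ^ p * X 1 ^ p * X 2 : MvPolynomial (Fin 4) K) =
      monomial (Finsupp.single 0 (2 * p) + Finsupp.single 1 p + Finsupp.single 2 1) 1 +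
        monomial (Finsupp.single 0 p + Finsupp.single 1 p + Finsupp.single 2 1) (-1) := by
  have h1 : (X 0 ^ (2 * p) * X 1 ^ p * X 2 : MvPolynomial (Fin 4) K) =
      monomial (Finsupp.single 0 (2 * p) + Finsupp.single 1 p + Finsupp.single 2 1) 1 := by
    rw [X_pow_eq_monomial, X_pow_eq_monomial, X, monomial_mul, monomial_mul, mul_one, mul_one]
  have h2 : (X 0 ^ p * X 1 ^ p * X 2 : MvPolynomial (Fin 4) K) =
      monomial (Finsupp.single 0 p + Finsupp.single 1 p + Finsupp.single 2 1) 1 := by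
    rw [X_pow_eq_monomial, X_pow_eq_monomial, X, monomial_mul, monomial_mul, mul_one, mul_one]
  rw [h1, h2, map_neg, ← sub_eq_add_neg]

omit hp [CharP K p] in
/-- The support of `F` lies in its two exponents. [folklore] -/
theorem mem_support_twoWaiting {d : Fin 4 →₀ ℕ}
    (hd : d ∈ (X 0 ^ (2 * p) * X 1 ^ p * X 2 - X 0 ^ p * X 1 ^ p * X 2 : MvPolynomial (Fin 4) K).support) :
    d = Finsupp.single 0 (2 * p) + Finsupp.single 1 p + Finsupp.single 2 1 ∨
      d = Finsupp.single 0 p + Finsupp.single 1 p + Finsupp.single 2 1 := by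
  rw [twoWaiting_eq_monomial_add] at hd
  rcases Finset.mem_union.mp (Finset.mem_of_subset MvPolynomial.support_add hd) with h | h
  · exact Or.inl (Finset.mem_singleton.mp (Finset.mem_of_subset support_monomial_subset h))
  · exact Or.inr (Finset.mem_singleton.mp (Finset.mem_of_subset support_monomial_subset h))

omit [CharP K p] in
/-- `F` is clean (exponent `1` of `x₃` in both monomials). [cite: HauserPerlega2019PRIMS, §2 (cleaning)] -/
theorem isClean_twoWaiting :
    Literature.Barriers.ResolutionOfSingularities.HauserPerlega.IsClean p
      (X 0 ^ (2 * p) * X 1 ^ p * X 2 - X 0 ^ p * X 1 ^ p * X 2 : MvPolynomial (Fin 4) K) := by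
  intro d hd hpth
  have key : ∀ i : Fin 4, d i = 1 → False := fun i hi => by
    have h := hpth i (by rw [Finsupp.mem_support_iff, hi]; exact one_ne_zero)
    rw [hi] at h
    exact hp.out.one_lt.ne' (Nat.dvd_one.mp h)
  rcases mem_support_twoWaiting hd with rfl | rfl
  · exact key 2 (by simp)
  · exact key 2 (by simp)

omit [CharP K p] in
/-- `F ≠ 0`. [folklore] -/
theorem twoWaiting_ne_zero : (X 0 ^ (2 * p) * X 1 ^ p * X 2 - X 0 ^ p * X 1 ^ p * X 2 : MvPolynomial (Fin 4) K) ≠ 0 := by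
  intro h
  have hc := congrArg (coeff (Finsupp.single (0 : Fin 4) p + Finsupp.single 1 p + Finsupp.single 2 1)) h
  have hp0 : p ≠ 0 := hp.out.ne_zero
  have n1 : (Finsupp.single (0 : Fin 4) (2 * p) + Finsupp.single 1 p + Finsupp.single 2 1) ≠
      Finsupp.single 0 p + Finsupp.single 1 p + Finsupp.single 2 1 := fun h' => by
    have := DFunLike.congr_fun h' 0; simp at this; omega
  rw [twoWaiting_eq_monomial_add, coeff_add, coeff_monomial, if_neg n1, coeff_monomial, if_pos rfl, coeff_zero] at hc
  simp at hc

omit hp [CharP K p] in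
/-- **`V(z, x₂)` is Hironaka-permissible for `z^p + F`** (the host). [cite: HauserPerlega2019PRIMS, §2 (condition (1))] -/
theorem isPermissibleCentre_S_twoWaiting :
    IsPermissibleCentre p ({1} : Finset (Fin 4)) (X 0 ^ (2 * p) * X 1 ^ p * X 2 - X 0 ^ p * X 1 ^ p * X 2 : MvPolynomial (Fin 4) K) := by
  refine ⟨⟨1, Finset.mem_singleton_self _⟩, Finset.le_inf fun d hd => ?_⟩
  rcases mem_support_twoWaiting hd with rfl | rfl <;> simp [CentreBlowup.degIn_singleton]

omit hp [CharP K p] in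
/-- **`V(z, x₁)` is Hironaka-permissible for `z^p + F`** (the first waiting member). [cite: HauserPerlega2019PRIMS, §2 (condition (1))] -/
theorem isPermissibleCentre_T_twoWaiting :
    IsPermissibleCentre p ({0} : Finset (Fin 4)) (X 0 ^ (2 * p) * X 1 ^ p * X 2 - X 0 ^ p * X 1 ^ p * X 2 : MvPolynomial (Fin 4) K) := by
  refine ⟨⟨0, Finset.mem_singleton_self _⟩, Finset.le_inf fun d hd => ?_⟩
  rcases mem_support_twoWaiting hd with rfl | rfl <;> simp [CentreBlowup.degIn_singleton]
  exact_mod_cast (show p ≤ 2 * p by omega)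

/-- **`F(x + e₁) = x₁^{2p} x₂^p x₃ + x₁^p x₂^p x₃`** (the second waiting member re-centred: `(x₁ + 1)² − (x₁ + 1) = x₁² + x₁`).
[cite: Hauser2010, §F (translation)] -/
theorem translate_e₀_twoWaiting :
    PointBlowup.translate (Pi.single 0 1 : Fin 4 → K)
        (X 0 ^ (2 * p) * X 1 ^ p * X 2 - X 0 ^ p * X 1 ^ p * X 2 : MvPolynomial (Fin 4) K) =
      X 0 ^ (2 * p) * X 1 ^ p * X 2 + X 0 ^ p * X 1 ^ p * X 2 := by
  unfold PointBlowup.translate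
  simp only [map_sub, map_mul, map_pow, aeval_X, Pi.single_eq_same, C_1,
    Pi.single_eq_of_ne (show (1 : Fin 4) ≠ 0 by decide), Pi.single_eq_of_ne (show (2 : Fin 4) ≠ 0 by decide), C_0, add_zero]
  rw [mul_comm 2 p, pow_mul, pow_mul, add_pow_char, one_pow]
  ring

omit hp [CharP K p] in
/-- **`V(z, x₁)` is permissible for `z^p + F(x + e₁)`** (the second waiting member). [cite: HauserPerlega2019PRIMS, §2 (condition (1))] -/
theorem isPermissibleCentre_T'_twoWaiting :
    IsPermissibleCentre p ({0} : Finset (Fin 4)) (X 0 ^ (2 * p) * X 1 ^ p * X 2 + X 0 ^ p * X 1 ^ p * X 2 : MvPolynomial (Fin 4) K) := by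
  have h1 : (X 0 ^ (2 * p) * X 1 ^ p * X 2 : MvPolynomial (Fin 4) K) =
      monomial (Finsupp.single 0 (2 * p) + Finsupp.single 1 p + Finsupp.single 2 1) 1 := by
    rw [X_pow_eq_monomial, X_pow_eq_monomial, X, monomial_mul, monomial_mul, mul_one, mul_one]
  have h2 : (X 0 ^ p * X 1 ^ p * X 2 : MvPolynomial (Fin 4) K) =
      monomial (Finsupp.single 0 p + Finsupp.single 1 p + Finsupp.single 2 1) 1 := by
    rw [X_pow_eq_monomial, X_pow_eq_monomial, X, monomial_mul, monomial_mul, mul_one, mul_one]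
  refine ⟨⟨0, Finset.mem_singleton_self _⟩, Finset.le_inf fun d hd => ?_⟩
  rw [h1, h2] at hd
  rcases Finset.mem_union.mp (Finset.mem_of_subset MvPolynomial.support_add hd) with h | h <;>
    have := Finset.mem_singleton.mp (Finset.mem_of_subset support_monomial_subset h) <;> subst this <;>
    simp [CentreBlowup.degIn_singleton]
  exact_mod_cast (show p ≤ 2 * p by omega)

/-- `u^p (u^p − 1) = 0` forces `u = 0 ∨ u = 1` (Frobenius is injective). [folklore] -/
theorem eq_zero_or_one_of_pow (u : K) (h : u ^ p * (u ^ p - 1) = 0) : u = 0 ∨ u = 1 := by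
  have hp0 : p ≠ 0 := hp.out.ne_zero
  rcases mul_eq_zero.mp h with h | h
  · exact Or.inl (pow_eq_zero_iff hp0 |>.mp h)
  · right
    have : (u - 1) ^ p = 0 := by rw [sub_pow_char, one_pow]; exact sub_eq_zero.mpr (sub_eq_zero.mp h)
    exact sub_eq_zero.mp (pow_eq_zero_iff hp0 |>.mp this)

/-- **The root parameters**: order `p` at `(a, b)` forces `b₂ = 0 ∨ b₁ = 0 ∨ b₁ = 1` (`∂F/∂x₃ = (x₁² − x₁)^p x₂^p`).
[cite: Hauser2010, §F (equiconstant points)] -/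
theorem roots_twoWaiting (b : Fin 4 → K)
    (H : ∀ d : Fin 4 →₀ ℕ, d ≠ 0 → d.degree < p → coeff d (PointBlowup.translate b
      (X 0 ^ (2 * p) * X 1 ^ p * X 2 - X 0 ^ p * X 1 ^ p * X 2 : MvPolynomial (Fin 4) K)) = 0) :
    b 1 = 0 ∨ b 0 = 0 ∨ b 0 = 1 := by
  have hp0 : p ≠ 0 := hp.out.ne_zero
  have h2 := eval_pderiv_eq_zero_of_forall_coeff b _ H 2
  simp [(pderiv (2 : Fin 4)).leibniz_pow] at h2
  have key : b 1 ^ p * (b 0 ^ p * (b 0 ^ p - 1)) = 0 := by rw [pow_mul'] at h2; linear_combination h2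
  rcases mul_eq_zero.mp key with h | h
  · exact Or.inl (pow_eq_zero_iff hp0 |>.mp h)
  · exact Or.inr (eq_zero_or_one_of_pow _ h)

omit hp [CharP K p] in
/-- **The `x₂`-chart of the blow-up of the host reads `(y₁^{2p} − y₁^p)·y₃`.** [cite: HauserPerlega2019PRIMS, §2 (the x₁-chart)] -/
theorem chartTransform_S_twoWaiting :
    CentreBlowup.chartTransform p ({1} : Finset (Fin 4)) 1
        (X 0 ^ (2 * p) * X 1 ^ p * X 2 - X 0 ^ p * X 1 ^ p * X 2 : MvPolynomial (Fin 4) K) =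
      X 0 ^ (2 * p) * X 2 - X 0 ^ p * X 2 := by
  rw [twoWaiting_eq_monomial_add, CentreBlowup.chartTransform_monomial_add_monomial]
  simp only [CentreBlowup.chartExponent, CentreBlowup.degIn_singleton]
  have e1 : (Finsupp.single 0 (2 * p) + Finsupp.single 1 p + Finsupp.single 2 1 : Fin 4 →₀ ℕ).update 1
      ((Finsupp.single 0 (2 * p) + Finsupp.single 1 p + Finsupp.single 2 1 : Fin 4 →₀ ℕ) 1 - p) =
        Finsupp.single 0 (2 * p) + Finsupp.single 2 1 := by
    ext i; fin_cases i <;> simp [Finsupp.update_apply]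
  have e2 : (Finsupp.single 0 p + Finsupp.single 1 p + Finsupp.single 2 1 : Fin 4 →₀ ℕ).update 1
      ((Finsupp.single 0 p + Finsupp.single 1 p + Finsupp.single 2 1 : Fin 4 →₀ ℕ) 1 - p) =
        Finsupp.single 0 p + Finsupp.single 2 1 := by
    ext i; fin_cases i <;> simp [Finsupp.update_apply]
  rw [e1, e2, ← X_pow_mul_X_eq_monomial, map_neg, ← X_pow_mul_X_eq_monomial, ← sub_eq_add_neg]

/-- **The equimultiple pairs of the host's chart lie on the two waiting kids**: `b₁ = 0 ∨ b₁ = 1` (the linear coefficient of `y₃` is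
`b₁^{2p} − b₁^p`). [cite: Hauser2010, §F (equiconstant points)] -/
theorem cases_twoWaiting [DecidableEq K] {b : Fin 4 → K} (s : State K)
    (hs : s.F = X 0 ^ (2 * p) * X 1 ^ p * X 2 - X 0 ^ p * X 1 ^ p * X 2)
    (h : CentreBlowup.IsEquimultiplePoint p ({1} : Finset (Fin 4)) 1 b s) : b 0 = 0 ∨ b 0 = 1 := by
  unfold CentreBlowup.IsEquimultiplePoint CentreBlowup.pointTransform at h
  rw [hs, chartTransform_S_twoWaiting] at h
  have h2 := eval_pderiv_eq_zero_of_forall_coeff b _ h 2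
  simp [(pderiv (2 : Fin 4)).leibniz_pow] at h2
  apply eq_zero_or_one_of_pow
  rw [pow_mul'] at h2
  linear_combination h2

omit [CharP K p] in
/-- `(y₁^{2p} + ε y₁^p)·y₃` is clean for `ε = ∓1` (exponent `1` of `y₃`). [cite: HauserPerlega2019PRIMS, §2 (cleaning)] -/
theorem isClean_H_twoWaiting (ε : K) :
    Literature.Barriers.ResolutionOfSingularities.HauserPerlega.IsClean p (X 0 ^ (2 * p) * X 2 + C ε * (X 0 ^ p * X 2) : MvPolynomial (Fin 4) K) := by
  intro d hd hpth
  have h1 : (X 0 ^ (2 * p) * X 2 : MvPolynomial (Fin 4) K) = monomial (Finsupp.single 0 (2 * p) + Finsupp.single 2 1) 1 :=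
    X_pow_mul_X_eq_monomial 0 2
  have h2 : (C ε * (X 0 ^ p * X 2) : MvPolynomial (Fin 4) K) = monomial (Finsupp.single 0 p + Finsupp.single 2 1) ε := by
    rw [X_pow_mul_X_eq_monomial, C_mul_monomial, mul_one]
  rw [h1, h2] at hd
  have key : ∀ i : Fin 4, d i = 1 → False := fun i hi => by
    have h := hpth i (by rw [Finsupp.mem_support_iff, hi]; exact one_ne_zero)
    rw [hi] at h
    exact hp.out.one_lt.ne' (Nat.dvd_one.mp h)
  rcases Finset.mem_union.mp (Finset.mem_of_subset MvPolynomial.support_add hd) with h | h <;>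
    have := Finset.mem_singleton.mp (Finset.mem_of_subset support_monomial_subset h) <;> subst this
  · exact key 2 (by simp)
  · exact key 2 (by simp)

omit [CharP K p] in
/-- **The first waiting kid's state**: `(step p {x₂} x₂ 0 (F, 0, ∅)).F = y₁^{2p} y₃ − y₁^p y₃`. [cite: Hauser2010, §§F–G] -/
theorem step_zero_twoWaiting [DecidableEq K] :
    (CentreBlowup.step p ({1} : Finset (Fin 4)) 1 (0 : Fin 4 → K)
        (⟨X 0 ^ (2 * p) * X 1 ^ p * X 2 - X 0 ^ p * X 1 ^ p * X 2, 0, ∅⟩ : State K)).F =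
      X 0 ^ (2 * p) * X 2 + C (-1) * (X 0 ^ p * X 2) := by
  show deletePthPowers p (PointBlowup.translate (0 : Fin 4 → K) (CentreBlowup.chartTransform p ({1} : Finset (Fin 4)) 1
    (X 0 ^ (2 * p) * X 1 ^ p * X 2 - X 0 ^ p * X 1 ^ p * X 2 : MvPolynomial (Fin 4) K))) = _
  rw [chartTransform_S_twoWaiting, PointBlowup.translate_zero,
    show (X 0 ^ (2 * p) * X 2 - X 0 ^ p * X 2 : MvPolynomial (Fin 4) K) = X 0 ^ (2 * p) * X 2 + C (-1) * (X 0 ^ p * X 2) by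
      rw [map_neg, C_1, neg_one_mul, sub_eq_add_neg]]
  exact Literature.Barriers.ResolutionOfSingularities.HauserPerlega.deletePthPowers_eq_self (isClean_H_twoWaiting _)

/-- **The second waiting kid's state**: `(step p {x₂} x₂ e₁ (F, 0, ∅)).F = y₁^{2p} y₃ + y₁^p y₃`. [cite: Hauser2010, §§F–G] -/
theorem step_one_twoWaiting [DecidableEq K] :
    (CentreBlowup.step p ({1} : Finset (Fin 4)) 1 (Pi.single 0 1 : Fin 4 → K)
        (⟨X 0 ^ (2 * p) * X 1 ^ p * X 2 - X 0 ^ p * X 1 ^ p * X 2, 0, ∅⟩ : State K)).F =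
      X 0 ^ (2 * p) * X 2 + C 1 * (X 0 ^ p * X 2) := by
  show deletePthPowers p (PointBlowup.translate (Pi.single 0 1 : Fin 4 → K) (CentreBlowup.chartTransform p ({1} : Finset (Fin 4)) 1
    (X 0 ^ (2 * p) * X 1 ^ p * X 2 - X 0 ^ p * X 1 ^ p * X 2 : MvPolynomial (Fin 4) K))) = _
  have htr : PointBlowup.translate (Pi.single 0 1 : Fin 4 → K) (X 0 ^ (2 * p) * X 2 - X 0 ^ p * X 2 : MvPolynomial (Fin 4) K) =
      X 0 ^ (2 * p) * X 2 + C 1 * (X 0 ^ p * X 2) := by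
    unfold PointBlowup.translate
    simp only [map_sub, map_mul, map_pow, aeval_X, Pi.single_eq_same, C_1, one_mul,
      Pi.single_eq_of_ne (show (2 : Fin 4) ≠ 0 by decide), C_0, add_zero]
    rw [mul_comm 2 p, pow_mul, pow_mul, add_pow_char, one_pow]
    ring
  rw [chartTransform_S_twoWaiting, htr]
  exact Literature.Barriers.ResolutionOfSingularities.HauserPerlega.deletePthPowers_eq_self (isClean_H_twoWaiting _)

omit hp [CharP K p] in
/-- **The `y₁`-chart of the blow-up of a waiting kid `V(z′, y₁)` applied to `y₁^{2p} y₃ + ε y₁^p y₃` reads `y₁^p y₃ + ε y₃`.**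
[cite: HauserPerlega2019PRIMS, §2 (the x₁-chart)] -/
theorem chartTransform_T_twoWaiting (ε : K) :
    CentreBlowup.chartTransform p ({0} : Finset (Fin 4)) 0 (X 0 ^ (2 * p) * X 2 + C ε * (X 0 ^ p * X 2) : MvPolynomial (Fin 4) K) =
      X 0 ^ p * X 2 + C ε * X 2 := by
  have h2 : (C ε * (X 0 ^ p * X 2) : MvPolynomial (Fin 4) K) = monomial (Finsupp.single 0 p + Finsupp.single 2 1) ε := by
    rw [X_pow_mul_X_eq_monomial, C_mul_monomial, mul_one]
  rw [X_pow_mul_X_eq_monomial, h2, CentreBlowup.chartTransform_monomial_add_monomial]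
  simp only [CentreBlowup.chartExponent, CentreBlowup.degIn_singleton]
  have e1 : (Finsupp.single 0 (2 * p) + Finsupp.single 2 1 : Fin 4 →₀ ℕ).update 0
      ((Finsupp.single 0 (2 * p) + Finsupp.single 2 1 : Fin 4 →₀ ℕ) 0 - p) = Finsupp.single 0 p + Finsupp.single 2 1 := by
    ext i; fin_cases i <;> simp [Finsupp.update_apply]; omega
  have e2 : (Finsupp.single 0 p + Finsupp.single 2 1 : Fin 4 →₀ ℕ).update 0
      ((Finsupp.single 0 p + Finsupp.single 2 1 : Fin 4 →₀ ℕ) 0 - p) = Finsupp.single 2 1 := by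
    ext i; fin_cases i <;> simp [Finsupp.update_apply]
  rw [e1, e2, ← X_pow_mul_X_eq_monomial, show (monomial (Finsupp.single 2 1) ε : MvPolynomial (Fin 4) K) = C ε * X 2 by
    rw [X, C_mul_monomial, mul_one]]

omit [CharP K p] in
/-- **THE WAITING KIDS' BLOW-UPS ARE DEAD**: on the only chart `y₁` the linear coefficient of `y₃` is `b₁^p + ε = ε ≠ 0`.
[cite: Hauser2010, §F (equiconstant points)] -/
theorem not_isEquimultiplePoint_T_twoWaiting [DecidableEq K] {ε : K} (hε : ε ≠ 0) {k : Fin 4} (hk : k ∈ ({0} : Finset (Fin 4)))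
    (b : Fin 4 → K) (hbk : b k = 0) (s : State K) (hs : s.F = X 0 ^ (2 * p) * X 2 + C ε * (X 0 ^ p * X 2)) :
    ¬ CentreBlowup.IsEquimultiplePoint p ({0} : Finset (Fin 4)) k b s := by
  have hk' : k = 0 := Finset.mem_singleton.mp hk
  subst hk'
  have hp0 : p ≠ 0 := hp.out.ne_zero
  intro h
  unfold CentreBlowup.IsEquimultiplePoint CentreBlowup.pointTransform at h
  rw [hs, chartTransform_T_twoWaiting] at h
  have h2 := h (Finsupp.single 2 1) (Finsupp.single_ne_zero.mpr one_ne_zero) (by rw [Finsupp.degree_single]; exact hp.out.one_lt)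
  rw [coeff_single_one_translate] at h2
  simp [(pderiv (2 : Fin 4)).leibniz_pow, hbk, hp0] at h2
  exact hε h2

/-! ## §2 The certificate -/

/-- **A HOST WITH TWO WAITING MEMBERS, CERTIFIED** (every `p`): `(𝔸⁵_K, (z^p + (x₁² − x₁)^p x₂^p x₃)·𝒪, [], p)` admits a marked
resolution — host `V(z, x₂)` blown up first while `V(z, x₁)` and `V(z, x₁ − 1)` wait; then their two (disjoint) kids; nothing survives.
[cite: BierstoneGrigorievMilmanWlodarczyk2011, Def. 3.1.3] [cite: HauserPerlega2019PRIMS, §2 (permissible centres P = (z, x_i : i ∈ Γ))]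
[cite: Hauser2010, §F (equiconstant points)] -/
theorem exists_isMarkedResolution_inst₁₃ [IsAlgClosed K] [DecidableEq K] :
    ∃ (X' : Scheme.{0}) (ρ : X' ⟶ P 4 K) (M' : MarkedIdeal X'),
      IsMarkedResolution (⟨hypSheaf p (X 0 ^ (2 * p) * X 1 ^ p * X 2 - X 0 ^ p * X 1 ^ p * X 2 : MvPolynomial (Fin 4) K), [], p⟩ :
        MarkedIdeal (P 4 K)) ρ M' := by
  classical
  set F : MvPolynomial (Fin 4) K := X 0 ^ (2 * p) * X 1 ^ p * X 2 - X 0 ^ p * X 1 ^ p * X 2 with hFdef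
  set s₀ : State K := ⟨F, 0, ∅⟩ with hs₀def
  have hs₀ : s₀ = ⟨deletePthPowers p (PointBlowup.translate (0 : Fin 4 → K) F), 0, ∅⟩ := by
    rw [PointBlowup.translate_zero, Literature.Barriers.ResolutionOfSingularities.HauserPerlega.deletePthPowers_eq_self isClean_twoWaiting]
  set wt₁ : Fin 4 × (Fin 4 → K) × Finset (Fin 4) := ((1 : Fin 4), (0 : Fin 4 → K), ({0} : Finset (Fin 4))) with hwt₁
  set wt₂ : Fin 4 × (Fin 4 → K) × Finset (Fin 4) := ((1 : Fin 4), (Pi.single 0 1 : Fin 4 → K), ({0} : Finset (Fin 4))) with hwt₂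
  have hne : wt₁ ≠ wt₂ := fun h => by
    have := congrFun (congrArg (fun w => w.2.1) h) 0
    simp [hwt₁, hwt₂] at this
  have hH₁ : (CentreBlowup.step p ({1} : Finset (Fin 4)) 1 (0 : Fin 4 → K) s₀).F = X 0 ^ (2 * p) * X 2 + C (-1) * (X 0 ^ p * X 2) := by
    rw [hs₀def, hFdef]; exact step_zero_twoWaiting
  have hH₂ : (CentreBlowup.step p ({1} : Finset (Fin 4)) 1 (Pi.single 0 1 : Fin 4 → K) s₀).F =
      X 0 ^ (2 * p) * X 2 + C 1 * (X 0 ^ p * X 2) := by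
    rw [hs₀def, hFdef]; exact step_one_twoWaiting
  refine exists_isMarkedResolution_depth_two_waiting_cert (p := p) F twoWaiting_ne_zero isClean_twoWaiting 0 ({1} : Finset (Fin 4))
    s₀ hs₀ isPermissibleCentre_S_twoWaiting ∅ {wt₁, wt₂} ∅ (fun e he => absurd he (Finset.notMem_empty e))
    (fun e he => absurd he (Finset.notMem_empty e)) (fun wt hwt => ?_) (fun wt hwt wt' hwt' hne' _ => ?_)
    (fun e he => absurd he (Finset.notMem_empty e)) (fun j' b' hj' hb' _ heq => ?_) (fun b' H => ?_)
    (fun e he => absurd he (Finset.notMem_empty e)) (fun wt hwt j'' b'' hj'' hb'' => ?_)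
    (fun l hl => absurd hl (Finset.notMem_empty l))
  · -- the two waiting entries are admissible
    rcases Finset.mem_insert.mp hwt with rfl | hwt
    · refine ⟨Finset.mem_singleton_self _, fun i _ => rfl, by show (({1} : Finset (Fin 4)).erase 1) ⊆ ({0} : Finset (Fin 4)); decide,
        by show (1 : Fin 4) ∉ ({0} : Finset (Fin 4)); decide, ?_⟩
      change IsPermissibleCentre p ({0} : Finset (Fin 4)) (PointBlowup.translate (0 : Fin 4 → K) F)
      rw [PointBlowup.translate_zero, hFdef]
      exact isPermissibleCentre_T_twoWaiting
    · rw [Finset.mem_singleton] at hwt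
      subst hwt
      refine ⟨Finset.mem_singleton_self _, fun i hi => ?_, by show (({1} : Finset (Fin 4)).erase 1) ⊆ ({0} : Finset (Fin 4)); decide,
        by show (1 : Fin 4) ∉ ({0} : Finset (Fin 4)); decide, ?_⟩
      · rw [Finset.mem_singleton] at hi; subst hi; simp [hwt₂]
      · change IsPermissibleCentre p ({0} : Finset (Fin 4)) (PointBlowup.translate (Pi.single 0 1 : Fin 4 → K) F)
        rw [hFdef, translate_e₀_twoWaiting]
        exact isPermissibleCentre_T'_twoWaiting
  · -- same chart: separated on `x₁` by `0 ≠ 1`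
    refine ⟨0, ?_, ?_, ?_⟩
    · rcases Finset.mem_insert.mp hwt with rfl | h <;> [skip; (rw [Finset.mem_singleton] at h; subst h)] <;>
        exact Finset.mem_singleton_self _
    · rcases Finset.mem_insert.mp hwt' with rfl | h <;> [skip; (rw [Finset.mem_singleton] at h; subst h)] <;>
        exact Finset.mem_singleton_self _
    · rcases Finset.mem_insert.mp hwt with rfl | h <;> rcases Finset.mem_insert.mp hwt' with rfl | h'
      · exact absurd rfl hne'
      · rw [Finset.mem_singleton] at h'; subst h'; simp [hwt₁, hwt₂]
      · rw [Finset.mem_singleton] at h; subst h; simp [hwt₁, hwt₂]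
      · rw [Finset.mem_singleton] at h h'; subst h; subst h'; exact absurd rfl hne'
  · -- three-way cover over the host: every pair lies on one of the two waiting kids
    have hj1 : j' = 1 := Finset.mem_singleton.mp hj'
    subst hj1
    rcases cases_twoWaiting s₀ rfl heq with hb0 | hb0
    · refine Or.inr (Or.inl ⟨wt₁, Finset.mem_insert_self _ _, rfl, fun i hi => ?_⟩)
      change i ∈ ({0} : Finset (Fin 4)) at hi
      rw [Finset.mem_singleton] at hi; subst hi; rw [hb0]; rfl
    · refine Or.inr (Or.inl ⟨wt₂, Finset.mem_insert_of_mem (Finset.mem_singleton_self _), rfl, fun i hi => ?_⟩)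
      change i ∈ ({0} : Finset (Fin 4)) at hi
      rw [Finset.mem_singleton] at hi; subst hi; rw [hb0]; simp [hwt₂]
  · -- the root cover: `b₂ = 0` (host), `b₁ = 0` (first waiting member), `b₁ = 1` (second)
    rcases roots_twoWaiting b' H with hb1 | hb0 | hb0
    · left
      intro i hi
      rw [Finset.mem_singleton] at hi; subst hi; rw [hb1]; rfl
    · refine Or.inr ⟨wt₁, Finset.mem_insert_self _ _, fun i hi => ?_⟩
      change i ∈ ({0} : Finset (Fin 4)) at hi
      rw [Finset.mem_singleton] at hi; subst hi; rw [hb0]; simp [hwt₁]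
    · refine Or.inr ⟨wt₂, Finset.mem_insert_of_mem (Finset.mem_singleton_self _), fun i hi => ?_⟩
      change i ∈ ({0} : Finset (Fin 4)) at hi
      rw [Finset.mem_singleton] at hi; subst hi; rw [hb0]; simp [hwt₂]
  · -- both waiting kids are dead
    rcases Finset.mem_insert.mp hwt with rfl | hwt
    · exact not_isEquimultiplePoint_T_twoWaiting (by norm_num) hj'' b'' hb'' _ hH₁
    · rw [Finset.mem_singleton] at hwt
      subst hwt
      exact not_isEquimultiplePoint_T_twoWaiting one_ne_zero hj'' b'' hb'' _ hH₂

end Instance₁₃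

end Equimultiple

end Summit.ResolutionOfSingularities.ResolutionOfSingularities.Theorems.PIDim4

end
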